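import Mathlib
import HarnessLib
import Literature.NumberTheory.DiophantineGeometry.AbcWave0
import Literature.NumberTheory.DiophantineGeometry.RothAssembly
import Literature.NumberTheory.DiophantineGeometry.RothLemma

/-!
# Roth's theorem (abc.S13) — discharge of the named fact `roth`

Source: K. F. Roth, *Rational approximations to algebraic numbers*, Mathematika 2 (1955) 1–20
[Roth1955], in the exposition of W. M. Schmidt, *Diophantine Approximation*, LNM 785 (1980),
Ch. V, Theorem 2A and §§4–11 [Schmidt1980] (Schmidt follows Cassels 1957).

`Literature.NumberTheory.DiophantineGeometry.roth` (`AbcWave0.lean`, **abc.S13**): an irrational real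
algebraic number is not `LiouvilleWith p` for any `p > 2`. This file closes it:
`roth_holds := roth_of_rothLemma Roth.rothLemma`, where

* `Roth.rothLemma` (`RothLemma.lean`) is Theorem 10A (Roth's Lemma), proved by induction from the
  case `m = 1` (`RothLemmaOne.lean`, Gauss's Lemma), the decomposition and generalized Wronskians
  (`RothLemmaDecomp.lean`, Lemma 9A in `RothWronskian.lean` / `RothWronskianOne.lean`), heights
  (`RothLemmaHeights.lean`), slices and transport (`RothLemmaTransport.lean`) and the completion of
  the proof (`RothLemmaTop.lean`);
* `roth_of_rothLemma` (`RothAssembly.lean`) is §11 of Schmidt — the choice of `ε`, `m`, the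
  approximations `p_h/q_h` and the degrees `r_h` — on top of the Index Theorem 7A
  (`RothIndexTheorem.lean`, with Lemmas 4A, 5C in `RothAuxLemmas.lean` and Siegel's lemma from
  Mathlib) and Theorem 8A (`RothNearbyRationals.lean`), all in the vocabulary of `RothPrelim.lean` /
  `RothTaylor.lean` (the operators `P ↦ P_i`, heights, the index).

The whole chain is sorry-free; the axioms are the standard ones.

## References

* [Roth1955] K. F. Roth, *Rational approximations to algebraic numbers*, Mathematika 2 (1955) 1–20.
* [Schmidt1980] W. M. Schmidt, *Diophantine Approximation*, LNM 785, Springer 1980, Ch. V,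
  Theorem 2A (p. 116) and §§4–11.
-/

noncomputable section

namespace Literature.NumberTheory.DiophantineGeometry

/-- **Roth's Theorem** (Roth 1955; Schmidt, LNM 785, Ch. V, Theorem 2A): the named fact `roth`
(**abc.S13**) holds — a real irrational algebraic number `x` is not `LiouvilleWith p` for any
`p > 2`, i.e. `|x - a/q| < q^{-2-δ}` has only finitely many solutions for each `δ > 0`.
Proof: Schmidt's Chapter V (Index Theorem 7A, Theorem 8A, Roth's Lemma 10A, §11).
[cite: Schmidt1980, Ch. V Theorem 2A and §11] -/
theorem roth_holds : roth :=
  roth_of_rothLemma Roth.rothLemma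

end Literature.NumberTheory.DiophantineGeometry
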